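import Literature.IUT.HodgeTheaters.InitialThetaDataLegendreProofs
import Literature.NumberTheory.EllipticCurves.TateCurve.TorsionRootNumberField
import HarnessLib

/-!
# Initial Θ-data: full `2`- and `l`-torsion over `K`, and the `2l`-th root of the `q`-parameter
# ([IUTchI] Def. 3.1 (b)(c) ⟹ Example 3.2 (iv) "`q_v` admits a `2l`-th root in `K_v̲`")

`Proofs` companion (theorems only; no definitions, no named facts, no instances) of
`Literature.IUT.HodgeTheaters.InitialThetaData` (abc-iut-L5-t2: the REAL [IUTchI] Def. 3.1), by the cell
`abc-iut` (seat abc-iut-w5-d209). Mochizuki, *Inter-universal Teichmüller theory I*, Example 3.2 (iv)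
(kurims May-2020 manuscript p. 71): "it follows from our assumption concerning `2`-torsion [cf. Definition
3.1, (b)], together with the definition of `K` [cf. Definition 3.1, (c)], that `q_v` admits a `2l`-th root in
`𝒪^▷(T_{X̲̲_v}) (≅ 𝒪^▷_{K_v̲})`". For `D : InitialThetaData F K Fbar E l Pb` this file proves:

* `InitialThetaData.mem_range_baseChange_of_fixesTorsion` — a point of `E_F(F̄)` fixed by every
  `σ ∈ G_F` acting trivially on `E_F[l]` comes from `E_F(K)` (Def. 3.1 (c): `K` is the fixed field of the
  kernel of `G_F → GL₂(𝔽_l)`, typed as `range_K_iff`);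
* `InitialThetaData.exists_finset_two_torsion` — `E_F(K)` contains `4 = 2²` points killed by `2` (Def. 3.1 (b)
  "the `2·3`-torsion points of `E_F` are rational over `F`", with the three roots of the `2`-division cubic,
  abc-iut-L5-t12's `exists_twoTorsion_roots`);
* `InitialThetaData.exists_finset_l_torsion` — `E_F(K)` contains `l²` points killed by `l` (the `𝔽_l`-basis of
  `E_F[l](F̄)` of Def. 3.1 (c) `imageContainsSL2`, descended to `K`);
* **`InitialThetaData.exists_pow_two_mul_l_eq_tateParameter`** — at a finite place `w` of `K` where
  `E_F ×_F K` has SPLIT multiplicative reduction, the Tate parameter `q_w ∈ K_w` (Silverman ATAEC V.5.3,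
  unconditional in the tree) is a `2l`-th power: `q_w = r ^ (2l)`, `r ∈ K_w`, with `w(j(E_F)) = (w r)⁻¹ ^ (2l)`
  — the `q̲_v` of [IUTchI] Ex. 3.2 (iv) (via the tree's `TorsionRoot*`: rational `n`-torsion on a Tate curve
  forces an `n`-th root of `q`, `n = 2` and `n = l` combined by coprimality).

What is NOT derived here (stated as the hypothesis `hsplit`): that `E_F ×_F K` has SPLIT multiplicative
reduction at the places `v̲ ∈ V̲^bad` — Def. 3.1 (b) gives multiplicative reduction of `E_F` over
`V^bad_mod` (`multiplicative_over_VbadMod`); splitness over `K_v̲` is a further classical consequence of the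
rational `3`-torsion (a non-split Tate twist has at most `n` rational points of odd order `n`), not yet in
the tree. Nothing of the series is asserted; no side is taken on [IUTchIII] Cor. 3.12.

## References
* [Mochizuki2012] S. Mochizuki, IUT I, Def. 3.1 (b)(c) pp. 61–62, Example 3.2 (iv) p. 71.
* [SilvermanATAEC1994] J. H. Silverman, *Advanced Topics in the Arithmetic of Elliptic Curves*, GTM 151,
  Thm. V.3.1 (c)(d) (PDF p. 395), Thm. V.5.3 (PDF pp. 407–409).
* [SilvermanAEC2009] J. H. Silverman, *The Arithmetic of Elliptic Curves*, 2nd ed., III.2.3 (d), VIII.§1.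
-/

noncomputable section

open scoped Classical
open WeierstrassCurve

universe u v w

namespace Literature.IUT.HodgeTheaters

/-! ### Generic group-theoretic finsets of torsion -/

section Finsets

variable {A : Type*} [AddCommGroup A]

/-- Three distinct nonzero elements killed by `2` give, with `0`, a `4`-element set killed by `2`.
[cite: SilvermanAEC2009, III.2.3(d)] -/
theorem exists_finset_card_four_of_two_torsion (T₁ T₂ T₃ : A) (h₁ : 2 • T₁ = 0) (h₂ : 2 • T₂ = 0)
    (h₃ : 2 • T₃ = 0) (h₁0 : T₁ ≠ 0) (h₂0 : T₂ ≠ 0) (h₃0 : T₃ ≠ 0) (h₁₂ : T₁ ≠ T₂) (h₁₃ : T₁ ≠ T₃)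
    (h₂₃ : T₂ ≠ T₃) : ∃ S : Finset A, S.card = 4 ∧ ∀ P ∈ S, 2 • P = 0 := by
  refine ⟨{0, T₁, T₂, T₃}, ?_, ?_⟩
  · rw [Finset.card_insert_of_notMem (by simp [Ne.symm h₁0, Ne.symm h₂0, Ne.symm h₃0]),
      Finset.card_insert_of_notMem (by simp [h₁₂, h₁₃]),
      Finset.card_insert_of_notMem (by simp [h₂₃]), Finset.card_singleton]
  · intro P hP
    simp only [Finset.mem_insert, Finset.mem_singleton] at hP
    rcases hP with rfl | rfl | rfl | rfl
    · exact smul_zero _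
    · exact h₁
    · exact h₂
    · exact h₃

/-- An `𝔽_l`-independent pair `P, Q` of elements killed by `l` spans `l²` distinct elements `aP + bQ`
(`0 ≤ a, b < l`), all killed by `l`. [cite: SilvermanAEC2009, III.6.4] -/
theorem exists_finset_card_sq_of_independent {l : ℕ} (hl : 0 < l) (P Q : A) (hP : (l : ℤ) • P = 0)
    (hQ : (l : ℤ) • Q = 0) (hind : ∀ a b : ℤ, a • P + b • Q = 0 → (l : ℤ) ∣ a ∧ (l : ℤ) ∣ b) :
    ∃ S : Finset A, S.card = l ^ 2 ∧ ∀ T ∈ S, l • T = 0 := by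
  let f : ℕ × ℕ → A := fun ab => (ab.1 : ℤ) • P + (ab.2 : ℤ) • Q
  have hinj : Set.InjOn f ↑(Finset.range l ×ˢ Finset.range l) := by
    rintro ⟨a, b⟩ hab ⟨a', b'⟩ hab' h
    simp only [Finset.coe_product, Finset.coe_range, Set.mem_prod, Set.mem_Iio] at hab hab'
    have h0 : ((a : ℤ) - a') • P + ((b : ℤ) - b') • Q = 0 := by
      simp only [f] at h
      rw [sub_smul, sub_smul]
      have : (a : ℤ) • P + (b : ℤ) • Q - ((a' : ℤ) • P + (b' : ℤ) • Q) = 0 := sub_eq_zero.mpr h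
      rw [← this]
      abel
    obtain ⟨ha, hb⟩ := hind _ _ h0
    have ha' : (a : ℤ) = a' := by
      rcases ha with ⟨c, hc⟩
      have : |(a : ℤ) - a'| < l := by rw [abs_sub_lt_iff]; omega
      rw [hc, abs_mul, Nat.abs_cast] at this
      have hc0 : c = 0 := by
        by_contra hc0
        have : (l : ℤ) * 1 ≤ (l : ℤ) * |c| := by
          exact mul_le_mul_of_nonneg_left (Int.one_le_abs hc0) (by positivity)
        omega
      rw [hc0, mul_zero, sub_eq_zero] at hc
      exact hc
    have hb' : (b : ℤ) = b' := by
      rcases hb with ⟨c, hc⟩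
      have : |(b : ℤ) - b'| < l := by rw [abs_sub_lt_iff]; omega
      rw [hc, abs_mul, Nat.abs_cast] at this
      have hc0 : c = 0 := by
        by_contra hc0
        have : (l : ℤ) * 1 ≤ (l : ℤ) * |c| := by
          exact mul_le_mul_of_nonneg_left (Int.one_le_abs hc0) (by positivity)
        omega
      rw [hc0, mul_zero, sub_eq_zero] at hc
      exact hc
    exact Prod.ext (by exact_mod_cast ha') (by exact_mod_cast hb')
  refine ⟨(Finset.range l ×ˢ Finset.range l).image f, ?_, ?_⟩
  · rw [Finset.card_image_of_injOn hinj, Finset.card_product, Finset.card_range, sq]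
  · intro T hT
    obtain ⟨⟨a, b⟩, -, rfl⟩ := Finset.mem_image.mp hT
    simp only [f]
    rw [← natCast_zsmul, smul_add, smul_comm (l : ℤ) (a : ℤ) P, smul_comm (l : ℤ) (b : ℤ) Q, hP, hQ,
      smul_zero, smul_zero, add_zero]

end Finsets

/-! ### Torsion of `E_F` over `K` for initial Θ-data -/

section Torsion

variable {F : Type u} {K : Type v} {Fbar : Type w} [Field F] [NumberField F] [Field K]
  [NumberField K] [Algebra F K] [Field Fbar] [Algebra F Fbar] [Algebra K Fbar] [IsScalarTower F K Fbar]
  {E : WeierstrassCurve F} [E.IsElliptic] {l : ℕ} {Pb : BadPlacePredicates K}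
  (D : InitialThetaData F K Fbar E l Pb)

namespace InitialThetaData

include D

/-- **Descent to `K` of `G`-fixed geometric points**: a point of `E_F(F̄)` fixed by every `σ ∈ G_F` that
acts trivially on `E_F[l](F̄)` comes from a point of `E_F(K)` — its coordinates lie in `K`, the fixed field
of the kernel of `G_F → GL₂(𝔽_l)` (Def. 3.1 (c), `range_K_iff`). [claim: Mochizuki2012, status: disputed] -/
theorem mem_range_baseChange_of_fixesTorsion (T : GeomPoints Fbar E)
    (hT : ∀ σ : Fbar ≃ₐ[F] Fbar, FixesTorsion E l σ → galoisAct E σ T = T) :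
    T ∈ Set.range (Affine.Point.baseChange (W' := E.toAffine) K Fbar) := by
  rcases T with _ | ⟨x, y, h⟩
  · exact ⟨0, by rw [map_zero]; rfl⟩
  · have hx : x ∈ Set.range (algebraMap K Fbar) := by
      rw [D.range_K_iff]
      intro σ hσ
      have h1 := hT σ hσ
      rw [galoisAct, Affine.Point.map_some, Affine.Point.some.injEq] at h1
      exact h1.1
    have hy : y ∈ Set.range (algebraMap K Fbar) := by
      rw [D.range_K_iff]
      intro σ hσ
      have h1 := hT σ hσ
      rw [galoisAct, Affine.Point.map_some, Affine.Point.some.injEq] at h1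
      exact h1.2
    obtain ⟨x₀, rfl⟩ := hx
    obtain ⟨y₀, rfl⟩ := hy
    have h₀ : (E.toAffine.baseChange K).Nonsingular x₀ y₀ :=
      (E.toAffine.baseChange_nonsingular (f := Algebra.ofId K Fbar) (algebraMap K Fbar).injective
        x₀ y₀).mp h
    exact ⟨Affine.Point.some x₀ y₀ h₀, rfl⟩

/-- Every `l`-torsion point of `E_F(F̄)` comes from `E_F(K)` ("`K := F(E_F[l])`", Def. 3.1 (c)).
[claim: Mochizuki2012, status: disputed] -/
theorem mem_range_baseChange_of_l_torsion (T : GeomPoints Fbar E) (hT : (l : ℤ) • T = 0) :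
    T ∈ Set.range (Affine.Point.baseChange (W' := E.toAffine) K Fbar) :=
  D.mem_range_baseChange_of_fixesTorsion T fun _ hσ => hσ T hT

/-- Every `2`-torsion point of `E_F(F̄)` comes from `E_F(K)` (it even comes from `E_F(F)`, Def. 3.1 (b);
`F`-points are fixed by all of `G_F`). [claim: Mochizuki2012, status: disputed] -/
theorem mem_range_baseChange_of_two_torsion (T : GeomPoints Fbar E) (hT : (2 : ℤ) • T = 0) :
    T ∈ Set.range (Affine.Point.baseChange (W' := E.toAffine) K Fbar) := by
  refine D.mem_range_baseChange_of_fixesTorsion T fun σ _ => ?_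
  exact Affine.Point.map_algEquiv_eq_self_of_mem_range_baseChange σ (D.two_torsion_rational T hT)

/-- **`E_F(K)` has full `2`-torsion**: four distinct points killed by `2` (the three points of order `2`, whose
abscissae are the roots of the `2`-division cubic — rational by Def. 3.1 (b) — and `O`).
[claim: Mochizuki2012, status: disputed] -/
theorem exists_finset_two_torsion :
    ∃ S : Finset (E.toAffine.baseChange K).Point, S.card = 4 ∧ ∀ P ∈ S, 2 • P = 0 := by
  haveI := D.isAlgClosure
  haveI : CharZero Fbar := charZero_of_injective_algebraMap (algebraMap F Fbar).injective
  haveI : CharZero K := charZero_of_injective_algebraMap (algebraMap F K).injective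
  haveI : (E.baseChange Fbar).IsElliptic := inferInstanceAs (E.map (algebraMap F Fbar)).IsElliptic
  obtain ⟨e₁, e₂, e₃, h3⟩ := D.exists_twoTorsion_roots
  obtain ⟨h12, h13, h23⟩ := E.roots_ne_of_roots_eq h3
  -- the mapped cubic is the `2`-division cubic of `E/F̄`
  have hmap : Cubic.map (algebraMap F Fbar) E.twoTorsionPolynomial =
      (E.baseChange Fbar).twoTorsionPolynomial := by
    change _ = (E.map (algebraMap F Fbar)).twoTorsionPolynomial
    simp only [twoTorsionPolynomial, Cubic.map, map_b₂, map_b₄, map_b₆, map_ofNat, map_mul]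
  -- geometric points of order `2` above each root, descended to `K`
  have key : ∀ e : F, algebraMap F Fbar e ∈ (Cubic.map (algebraMap F Fbar) E.twoTorsionPolynomial).roots →
      ∃ T : (E.toAffine.baseChange K).Point, T ≠ 0 ∧ 2 • T = 0 ∧
        ∃ (y : Fbar) (h : (E.baseChange Fbar).toAffine.Nonsingular (algebraMap F Fbar e) y),
          Affine.Point.baseChange (W' := E.toAffine) K Fbar T = Affine.Point.some _ _ h := by
    intro e he
    rw [hmap] at he
    obtain ⟨y, hns, h2⟩ := (E.baseChange Fbar).exists_two_torsion_point_of_mem_roots he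
    obtain ⟨T, hT⟩ := D.mem_range_baseChange_of_two_torsion (Affine.Point.some _ _ hns) h2
    refine ⟨T, ?_, ?_, y, hns, hT⟩
    · rintro rfl
      rw [map_zero] at hT
      exact Affine.Point.some_ne_zero _ hT.symm
    · apply Affine.Point.map_injective (f := Algebra.ofId K Fbar)
      change Affine.Point.baseChange K Fbar (2 • T) = Affine.Point.baseChange K Fbar 0
      rw [map_nsmul, map_zero, hT, ← natCast_zsmul]
      exact h2
  obtain ⟨T₁, h₁0, h₁, y₁, hn₁, hT₁⟩ := key e₁ (by rw [h3]; simp)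
  obtain ⟨T₂, h₂0, h₂, y₂, hn₂, hT₂⟩ := key e₂ (by rw [h3]; simp)
  obtain ⟨T₃, h₃0, h₃, y₃, hn₃, hT₃⟩ := key e₃ (by rw [h3]; simp)
  refine exists_finset_card_four_of_two_torsion T₁ T₂ T₃ h₁ h₂ h₃ h₁0 h₂0 h₃0 ?_ ?_ ?_
  · rintro rfl
    rw [hT₁, Affine.Point.some.injEq] at hT₂
    exact h12 hT₂.1
  · rintro rfl
    rw [hT₁, Affine.Point.some.injEq] at hT₃
    exact h13 hT₃.1
  · rintro rfl
    rw [hT₂, Affine.Point.some.injEq] at hT₃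
    exact h23 hT₃.1

/-- **`E_F(K)` has full `l`-torsion**: `l²` distinct points killed by `l` (the `𝔽_l`-basis `P, Q` of
`E_F[l](F̄)` of Def. 3.1 (c), `imageContainsSL2`, and its span, descended to `K := F(E_F[l])`).
[claim: Mochizuki2012, status: disputed] -/
theorem exists_finset_l_torsion :
    ∃ S : Finset (E.toAffine.baseChange K).Point, S.card = l ^ 2 ∧ ∀ P ∈ S, l • P = 0 := by
  obtain ⟨P, Q, hP, hQ, hind, -, -⟩ := D.imageContainsSL2.exists_basis
  obtain ⟨P₀, hP₀⟩ := D.mem_range_baseChange_of_l_torsion P hP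
  obtain ⟨Q₀, hQ₀⟩ := D.mem_range_baseChange_of_l_torsion Q hQ
  set ι := Affine.Point.baseChange (W' := E.toAffine) K Fbar with hι
  have hιinj : Function.Injective ι := Affine.Point.map_injective _
  have hP₀l : (l : ℤ) • P₀ = 0 := hιinj (by rw [map_zsmul, hP₀, map_zero, hP])
  have hQ₀l : (l : ℤ) • Q₀ = 0 := hιinj (by rw [map_zsmul, hQ₀, map_zero, hQ])
  refine exists_finset_card_sq_of_independent D.l_prime.pos P₀ Q₀ hP₀l hQ₀l fun a b hab => hind a b ?_
  have h := congrArg ι hab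
  rwa [map_add, map_zsmul, map_zsmul, hP₀, hQ₀, map_zero] at h

end InitialThetaData

end Torsion

/-! ### The `2l`-th root of the Tate parameter at a place of split multiplicative reduction -/

section QRoot

open Literature.NumberTheory.EllipticCurves Literature.NumberTheory.EllipticCurves.TateCurve
  Literature.NumberTheory.EllipticCurves.SteinWuthrich2013 NumberField IsDedekindDomain

variable {F K Fbar : Type} [Field F] [NumberField F] [Field K] [NumberField K] [Algebra F K]
  [Field Fbar] [Algebra F Fbar] [Algebra K Fbar] [IsScalarTower F K Fbar] {E : WeierstrassCurve F}
  [E.IsElliptic] {l : ℕ}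
  {Pb : BadPlacePredicates K} (D : InitialThetaData F K Fbar E l Pb)

/-- Transport of a finset of points killed by `n` along an EQUALITY of Weierstrass curves. [folklore] -/
private theorem exists_finset_torsion_of_eq {L : Type*} [Field L] {W₁ W₂ : WeierstrassCurve L} (h : W₁ = W₂)
    {n : ℕ} (S : Finset W₁.toAffine.Point) (hS : ∀ P ∈ S, n • P = 0) :
    ∃ S' : Finset W₂.toAffine.Point, S'.card = S.card ∧ ∀ P ∈ S', n • P = 0 := by
  subst h
  exact ⟨S, rfl, hS⟩

omit [NumberField F] [E.IsElliptic] in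
/-- Push-forward of a finset of `K`-points killed by `n` to the completion `K_w`, as points of
`(E_F ×_F K) ×_K K_w` (injective homomorphism `E_F(K) → E_F(K_w)`; the curves `E_F ×_F K_w` and
`(E_F ×_F K) ×_K K_w` coincide). [folklore] -/
private theorem exists_finset_torsion_completion (w : HeightOneSpectrum (𝓞 K)) {n : ℕ}
    (S : Finset (E.toAffine.baseChange K).Point) (hS : ∀ P ∈ S, n • P = 0) :
    ∃ S' : Finset ((E.baseChange K).baseChange (w.adicCompletion K)).toAffine.Point,
      S'.card = S.card ∧ ∀ P ∈ S', n • P = 0 := by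
  let f : K →ₐ[F] w.adicCompletion K := IsScalarTower.toAlgHom F K (w.adicCompletion K)
  let ι : (E.toAffine.baseChange K).Point →+ (E.toAffine.baseChange (w.adicCompletion K)).Point :=
    Affine.Point.map f
  have hι : Function.Injective ι := Affine.Point.map_injective f
  have hEq : E.baseChange (w.adicCompletion K) = (E.baseChange K).baseChange (w.adicCompletion K) := by
    rw [WeierstrassCurve.baseChange, WeierstrassCurve.baseChange, WeierstrassCurve.baseChange,
      WeierstrassCurve.map_map, ← IsScalarTower.algebraMap_eq]
  obtain ⟨S', hS', hS'n⟩ := exists_finset_torsion_of_eq hEq (S.map ⟨ι, hι⟩) (by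
    intro P hP
    obtain ⟨P₀, hP₀, rfl⟩ := Finset.mem_map.mp hP
    show n • ι P₀ = 0
    rw [← map_nsmul, hS P₀ hP₀, map_zero])
  exact ⟨S', by rw [hS', Finset.card_map], hS'n⟩

namespace InitialThetaData

include D

/-- **[IUTchI] Example 3.2 (iv) — `q_v` admits a `2l`-th root in `K_v̲`, GIVEN split multiplicative
reduction.** For initial Θ-data `D` and a finite place `w` of `K` at which `E_F ×_F K` has SPLIT multiplicative
reduction, the Tate parameter `q_w ∈ K_w` (Silverman ATAEC V.5.3: `q_w ≠ 0`, `‖q_w‖ < 1`, `tateJ q_w = j(E_F)`)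
is `r ^ (2l)` for some `r ∈ K_w`, and `w(j(E_F)) = (w r)⁻¹ ^ (2l)` (`2l ∣ ord_w(q_w) = −ord_w(j)`). Mechanism
(print: "our assumption concerning `2`-torsion … together with the definition of `K`"): `E_F(K)`, hence
`E_F(K_w)`, contains `2²` points killed by `2` and `l²` points killed by `l` (`exists_finset_two_torsion`,
`exists_finset_l_torsion`); on the Tate curve `K_w^×/q^ℤ` this forces `q = r₂² = r_lˡ`
(`exists_pow_eq_tateParameter_of_torsion_at`), and `gcd(2, l) = 1` (`l ≥ 5` prime) gives the `2l`-th root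
(`exists_pow_mul_eq_of_coprime`). [claim: Mochizuki2012, status: disputed] -/
theorem exists_pow_two_mul_l_eq_tateParameter (w : HeightOneSpectrum (𝓞 K))
    (hsplit : (E.baseChange K).HasSplitMultiplicativeReductionAt w) :
    ∃ q r : w.adicCompletion K, q ≠ 0 ∧ ‖q‖ < 1 ∧
      tateJ q = algebraMap K (w.adicCompletion K) (E.baseChange K).j ∧ r ^ (2 * l) = q ∧
      Valued.v (algebraMap K (w.adicCompletion K) (E.baseChange K).j) = ((Valued.v r)⁻¹) ^ (2 * l) := by
  letI := Literature.NumberTheory.GaloisRepresentations.Ultrametric.AdicCompletion.nontriviallyNormedField K w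
  haveI := charZero_adicCompletion' K w
  haveI : (E.baseChange K).IsElliptic := inferInstanceAs (E.map (algebraMap F K)).IsElliptic
  haveI : ((E.baseChange K).baseChange (w.adicCompletion K)).IsElliptic :=
    inferInstanceAs ((E.baseChange K).map (algebraMap K (w.adicCompletion K))).IsElliptic
  have hl : 0 < l := D.l_prime.pos
  -- the torsion over `K_w`
  obtain ⟨S₂, hS₂, hS₂t⟩ := D.exists_finset_two_torsion
  obtain ⟨S₂', hS₂', hS₂'t⟩ := exists_finset_torsion_completion w S₂ hS₂t
  obtain ⟨Sl, hSl, hSlt⟩ := D.exists_finset_l_torsion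
  obtain ⟨Sl', hSl', hSl't⟩ := exists_finset_torsion_completion w Sl hSlt
  -- a square root and an `l`-th root of the Tate parameter
  obtain ⟨q, r₂, hq0, hq, hqj, hr₂, hv₂⟩ := exists_pow_eq_tateParameter_of_torsion_at K w (E.baseChange K)
    hsplit two_pos S₂' hS₂'t (by rw [hS₂', hS₂]; norm_num)
  obtain ⟨q', rl, hq0', hq', hqj', hrl, -⟩ := exists_pow_eq_tateParameter_of_torsion_at K w (E.baseChange K)
    hsplit hl Sl' hSl't (by rw [hSl', hSl])
  have hj : ((E.baseChange K).baseChange (w.adicCompletion K)).j =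
      algebraMap K (w.adicCompletion K) (E.baseChange K).j := (E.baseChange K).map_j _
  have hqq : q' = q :=
    tateParameter_unique (E := (E.baseChange K).baseChange (w.adicCompletion K)) hq0' hq' (hqj'.trans hj.symm)
      hq0 hq (hqj.trans hj.symm)
  rw [hqq] at hrl
  -- combine: `gcd(2, l) = 1`
  have hcop : Nat.Coprime 2 l := (Nat.coprime_primes Nat.prime_two D.l_prime).mpr (by
    have := D.five_le_l; omega)
  obtain ⟨r, hr⟩ := exists_pow_mul_eq_of_coprime hq0 hcop hr₂ hrl
  refine ⟨q, r, hq0, hq, hqj, hr, ?_⟩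
  -- valuations: `v(j) = (v r₂)⁻¹ ^ 2 = (v q)⁻¹ = ((v r) ^ (2l))⁻¹`
  rw [hv₂, inv_pow, inv_pow, ← map_pow, ← map_pow, hr₂, hr]

end InitialThetaData

end QRoot

end Literature.IUT.HodgeTheaters

end
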